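/-
Copyright (c) 2026 the pub-hodgecm-mathlib formalisation cell (harness21).  Prover seat hodgecm-mathlib-K2E4-p14 (g5), Track B ∕ K2-LIT, h413 =
`stmt-HodgeConjecture-24833`, line `K2_E1_TraceFormulaBeta`, campaign «EIS-RANK-ONE»; [D8] «R5b-growth», banked by the dealer K2E1-plan (g3) 2026-09-04T06:09:14Z «for the next free hand»
(the LEFT-currency standard intertwining integral; this file is the `U(J₂)` twin: `∫_{N(𝔸)} H(w₀ v g)^σ dν = c(σ)·H(g)^{1−σ}`).
-/
import Summits.HodgeConjecture.HodgeConjecture.Theorems.K2E1MaassSelbergCMTwoConstantTerms   -- ★ p857847 (this seat): the `U(J₂)` twins of ED. 4∕5 and their closure (R3, R5a, R6a, p857524 `_two`)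
import Literature.NumberTheory.Automorphic.UnitaryGroupBorelModulusTwo                      -- ★ `torusRootModulus_two_eq`, `distribHaarChar_torus_two`, `map_torusConj_eq_torusRootModulus_smul_two`
import HarnessLib

/-!
# K2·E1 — `K2E1IntertwiningGrowthU2`: THE STANDARD INTERTWINING INTEGRAL OF `U(J₂)`, `∫_{N(𝔸)} H(w₀ v g)^σ dν = c(σ)·H(g)^{1−σ}`, AND THE FLAT GROWTH OF `M(w₀) f_z`
# (campaign «EIS-RANK-ONE», [D8] «R5b-growth» at `N = 2`: the twin of ★ `K2E1IntertwiningGrowthU3`; `2ρ_H = 1`, `δ_B(t) = ‖d₀‖`, `w₀ = ι(J₂)`)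

Track B ∕ K2-LIT, crux h413 = `stmt-HodgeConjecture-24833`, route of record `HCCMUnconditional`; cell `hodgecm-mathlib`, squad K2, ENGINE E1.  Prover seat
`hodgecm-mathlib-K2E4-p14` (g5); [D8] banked by K2E1-plan (g3) 06:09:14Z, census∕heads on the bus 06:3xZ.  THEOREMS ONLY (no `def`, no `instance`, no notation, no named-fact
hypothesis, no `sorry`); lane `--supports stmt-HodgeConjecture-24833 --as helper` (count-neutral).  Closes no socket.

THE MATHEMATICS [MoeglinWaldspurger1995, II.1.6; Garrett2018, §2.8; Rogawski1990, §2.2; GindikinKarpelevich].  `G = U(J₂)(𝔸_F)`, `w₀ = ι(J₂)`, `H` the Borel height (`H(g) = h(e₂ g)⁻¹`),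
`N(𝔸) = N(𝔸_F)` with a Haar measure `ν`.  LEFT convention throughout: `(M φ)(g) = ∫_{N(𝔸)} φ(w₀ v g) dν(v)`.
§1 ROWS: `e₂·w₀ = e₁`, so `lastRow (w₀ y) = row₁(y)` and, for `t = diag(d)`, `row₁(t x) = d₀·row₁(x)`: **`H(w₀ t x) = ‖d₀‖⁻¹·H(w₀ x)`** (★ `vecHeight_smul`).
§2 TORUS SCALING: `v ↦ t⁻¹ v t` multiplies `ν` by `δ_B(t) = torusRootModulus(d)` (★ `map_torusConj_eq_torusRootModulus_smul`), so
**`∫ H(w₀ v t x)^σ dν = δ_B(t)·‖d₀‖^{−σ}·∫ H(w₀ v x)^σ dν`**.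
§3 EVALUATION (Iwasawa `g = b k`, ★ `hBK`; Levi `b = t n`, ★ `torusPart`; `N(𝔸)` abelian ★; `H` right-`K_U`-invariant ★; `δ_B(t) = ‖d₀‖`, `H(b) = ‖d₁‖⁻¹ = ‖d₀‖` ★ torus relations):
**`∫_{N(𝔸)} H(w₀ v g)^σ dν(v) = c(σ) · H(g)^{1−σ}`, `c(σ) := ∫_{N(𝔸)} H(w₀ v)^σ dν(v)`**, for EVERY `g` and every real `σ` (no convergence needed: both sides carry the same Bochner junk).
§4 FINITENESS `c(σ) < ∞` (`σ = Re z`): the Godement finiteness of the standard section `H^z` at `g` in ★ R3's spelling gives `v ↦ H(w₀ v g)^{Re z} ∈ L¹(ν)` — ★ R5a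
`integrable_intertwiningU_integrand_quasiSplit_two` through ★ R3's left↔right dictionary and `v ↦ v⁻¹`.
§5 THE FLAT GROWTH OF `M(w₀) f_z` for `f_z = φ·H^z`, `‖φ‖ ≤ C_φ`: **`‖(M f_z)(g)·H(g)^{z−1}‖ ≤ C_φ·c(Re z)`** — the named input `hφ̃C` of ★ `maassSelberg_flatSectionU_two_int` DISCHARGED;
§6 **`maassSelberg_flatSectionU_two_fin`** = ★ `maassSelberg_flatSectionU_two_int` with `hφ̃C`, `hφ̃′C` gone.
HONEST LABEL: HC_CM is proved only modulo the 7 printed citations (2 remaining named inputs: hLiu418 = `stmt-HodgeConjecture-24832`, h413 = `stmt-HodgeConjecture-24833`) until rung 0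
closes; this file asserts no named fact and closes no socket.
References: [MoeglinWaldspurger1995] C. Mœglin, J.-L. Waldspurger, *Spectral Decomposition and Eisenstein Series* (1995), II.1.6–II.1.7 · [Garrett2018] §2.2, §2.8 · [Rogawski1990] §1.10, §2.2 ·
[Godement1964] §1.1.
-/

set_option autoImplicit false
-- the mandated namespace repeats the single-problem summit's segment (`HodgeConjecture.HodgeConjecture`)
set_option linter.dupNamespace false

noncomputable section

open MeasureTheory Measure NumberField IsDedekindDomain Set MulAction Filter Matrix
open scoped ENNReal NNReal ComplexConjugate MatrixGroups
open Literature.MeasureTheory.Group Literature.NumberTheory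
open Literature.NumberTheory.Automorphic Literature.NumberTheory.Automorphic.UnitaryGroup AdelicGroupData
open Summit.HodgeConjecture.HodgeConjecture.Cruxes.H413.K2E1BorelEisensteinU
open Summit.HodgeConjecture.HodgeConjecture.Cruxes.H413.K2E1MaassSelbergBracketsThree
open Summit.HodgeConjecture.HodgeConjecture.Cruxes.H413.K2E1EisensteinSeriesLeftRight (apply_mul_of_mem_borelQuotient)
open Summit.HodgeConjecture.HodgeConjecture.Cruxes.H413.K2E1EisensteinIntertwiningU (integrable_intertwiningU_integrand_quasiSplit_two)
open Summit.HodgeConjecture.HodgeConjecture.Cruxes.H413.K2E1BorelCosetsDictionary (forall_arithmeticBorel_iff)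
open Summit.HodgeConjecture.HodgeConjecture.Cruxes.H413.K2E1HeightFunctionU3 (borelHeight_one)
open Summit.HodgeConjecture.HodgeConjecture.Cruxes.H413.K2E1MaassSelbergCMTwoConstantTerms (maassSelberg_flatSectionU_two_int)

namespace Summit.HodgeConjecture.HodgeConjecture.Cruxes.H413.K2E1IntertwiningGrowthU2

variable {F E : Type} [Field F] [NumberField F] [Field E] [NumberField E] [Algebra F E] {c : E ≃ₐ[F] E}

/-! ## §1 Rows: `lastRow (w₀ y) = row₁(y)`, `H(w₀ t x) = ‖d₀‖⁻¹ H(w₀ x)` -/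

/-- **`e₂ · w₀ = e₁`**: the last row of `w₀ y` is the first row of `y` (`(J₂)_{2,k} = [k = 1]`, ★ `coe_coe_weylLongU`, ★ `StdForm.antidiagonal_over_apply`). [cite: MoeglinWaldspurger1995, I.2.2] -/
theorem lastRow_weylLongU_mul (y : (quasiSplit F E c 2).Adelic) :
    lastRow ((quasiSplit F E c 2).toAdelic (weylLongU (c : E →+* E) (rfl : (StdForm.antidiagonal 2).over E = (StdForm.antidiagonal 2).over E)) * y) =
      fun j => (adelicVal F E c 2 _ y : Matrix (Fin 2) (Fin 2) (AdeleRing (𝓞 E) E)) 0 j := by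
  have hW : lastRow ((quasiSplit F E c 2).toAdelic (weylLongU (c : E →+* E) (rfl : (StdForm.antidiagonal 2).over E = (StdForm.antidiagonal 2).over E))) =
      Pi.single (0 : Fin 2) (1 : AdeleRing (𝓞 E) E) := by
    funext k
    rw [lastRow_apply]
    change algebraMap E (AdeleRing (𝓞 E) E)
        ((((weylLongU (c : E →+* E) (rfl : (StdForm.antidiagonal 2).over E = (StdForm.antidiagonal 2).over E) :
          ↥(unitaryGroupOfForm (c : E →+* E) ((StdForm.antidiagonal 2).over E))) : GL (Fin 2) E) : Matrix (Fin 2) (Fin 2) E) ⊤ k) = _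
    rw [coe_coe_weylLongU, StdForm.antidiagonal_over_apply, show (⊤ : Fin 2).rev = 0 from by decide]
    by_cases hk : k = 0
    · subst hk; rw [if_pos rfl, map_one, Pi.single_eq_same]
    · rw [if_neg hk, map_zero, Pi.single_eq_of_ne hk]
  rw [lastRow_mul, hW, Matrix.single_vecMul, one_smul]
  rfl

/-- **`H(w₀ · t · x) = ‖d₀‖⁻¹ · H(w₀ · x)`** for `t = diag(d)`: `lastRow (w₀ t x) = row₁(t x) = d₀ · row₁(x) = d₀ · lastRow (w₀ x)` and ★ `vecHeight_smul`. [cite: Garrett2018, §2.2] -/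
theorem borelHeight_weylLongU_mul_diag_mul {t : (quasiSplit F E c 2).Adelic} {d : Fin 2 → (AdeleRing (𝓞 E) E)ˣ}
    (hd : glDiagonal 2 (AdeleRing (𝓞 E) E) d = adelicVal F E c 2 _ t) (x : (quasiSplit F E c 2).Adelic) :
    borelHeight ((quasiSplit F E c 2).toAdelic (weylLongU (c : E →+* E) (rfl : (StdForm.antidiagonal 2).over E = (StdForm.antidiagonal 2).over E)) * (t * x)) =
      (IdeleClassGroup.ideleNorm E (d 0))⁻¹ *
        borelHeight ((quasiSplit F E c 2).toAdelic (weylLongU (c : E →+* E) (rfl : (StdForm.antidiagonal 2).over E = (StdForm.antidiagonal 2).over E)) * x) := by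
  have hrow : lastRow ((quasiSplit F E c 2).toAdelic (weylLongU (c : E →+* E) (rfl : (StdForm.antidiagonal 2).over E = (StdForm.antidiagonal 2).over E)) * (t * x)) =
      ((d 0 : (AdeleRing (𝓞 E) E)ˣ) : AdeleRing (𝓞 E) E) •
        lastRow ((quasiSplit F E c 2).toAdelic (weylLongU (c : E →+* E) (rfl : (StdForm.antidiagonal 2).over E = (StdForm.antidiagonal 2).over E)) * x) := by
    rw [lastRow_weylLongU_mul, lastRow_weylLongU_mul]
    funext j
    rw [Pi.smul_apply, smul_eq_mul, map_mul, Units.val_mul, ← hd, coe_glDiagonal, Matrix.diagonal_mul]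
  rw [borelHeight_def, borelHeight_def, hrow, vecHeight_smul (isHeightFinite_lastRow _) (d 0), mul_inv]

/-! ## §2 Torus scaling of the standard intertwining integral -/

section Scaling

variable [MeasurableSpace (quasiSplit F E c 2).Adelic] [BorelSpace (quasiSplit F E c 2).Adelic]

/-- **`∫ H(w₀ v t x)^σ dν(v) = δ_B(t) · ‖d₀‖^{−σ} · ∫ H(w₀ v x)^σ dν(v)`** for `t = diag(d) ∈ T(𝔸_F)`: substitute `v = t u t⁻¹` (`v t = t u`; ★ `map_torusConj_eq_torusRootModulus_smul`:
`(u ↦ t⁻¹ u t)_* ν = δ_B(t)·ν`) and use §1 pointwise. [cite: MoeglinWaldspurger1995, II.1.6] [cite: Garrett2018, §2.8] -/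
theorem integral_borelHeight_weylLongU_torus_mul_rpow (hc : c * c = 1) (hc1 : c ≠ 1) (ν : Measure ↥(adelicUnipotent F E c 2)) [ν.IsHaarMeasure]
    (t : torusInBorel F E c 2) {d : Fin 2 → (AdeleRing (𝓞 E) E)ˣ}
    (hd : glDiagonal 2 (AdeleRing (𝓞 E) E) d = adelicVal F E c 2 _ ((t : borelAdelic F E c 2) : (quasiSplit F E c 2).Adelic)) (σ : ℝ) (x : (quasiSplit F E c 2).Adelic) :
    ∫ v : ↥(adelicUnipotent F E c 2), (borelHeight ((quasiSplit F E c 2).toAdelic (weylLongU (c : E →+* E) (rfl : (StdForm.antidiagonal 2).over E = (StdForm.antidiagonal 2).over E)) *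
        ((v : (quasiSplit F E c 2).Adelic) * (((t : borelAdelic F E c 2) : (quasiSplit F E c 2).Adelic) * x))) : ℝ) ^ σ ∂ν =
      (torusRootModulus E 2 d : ℝ) * ((IdeleClassGroup.ideleNorm E (d 0) : ℝ) ^ σ)⁻¹ *
        ∫ v : ↥(adelicUnipotent F E c 2), (borelHeight ((quasiSplit F E c 2).toAdelic (weylLongU (c : E →+* E) (rfl : (StdForm.antidiagonal 2).over E = (StdForm.antidiagonal 2).over E)) *
          ((v : (quasiSplit F E c 2).Adelic) * x)) : ℝ) ^ σ ∂ν := by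
  haveI := locallyCompactSpace_adeleRing' E
  letI : MeasurableSpace (AdeleRing (𝓞 E) E) := borel _
  haveI : BorelSpace (AdeleRing (𝓞 E) E) := ⟨rfl⟩
  set T : (quasiSplit F E c 2).Adelic := ((t : borelAdelic F E c 2) : (quasiSplit F E c 2).Adelic) with hT
  set W : (quasiSplit F E c 2).Adelic := (quasiSplit F E c 2).toAdelic (weylLongU (c : E →+* E) (rfl : (StdForm.antidiagonal 2).over E = (StdForm.antidiagonal 2).over E)) with hW
  -- the integrand as a function of `u = t⁻¹ v t`
  set Φ : ↥(adelicUnipotent F E c 2) → ℝ := fun u => (borelHeight (W * (T * ((u : (quasiSplit F E c 2).Adelic) * x))) : ℝ) ^ σ with hΦ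
  have hΦm : Measurable Φ :=
    (measurable_borelHeight.comp (continuous_const.mul (continuous_const.mul (continuous_subtype_val.mul continuous_const))).measurable).coe_nnreal_real.pow_const σ
  have hκ : Measurable fun u : ↥(adelicUnipotent F E c 2) => (⟨T⁻¹ * (u : (quasiSplit F E c 2).Adelic) * T,
      conj_mem_adelicUnipotent (t : borelAdelic F E c 2).2 u.2⟩ : ↥(adelicUnipotent F E c 2)) :=
    ((continuous_const.mul continuous_subtype_val).mul continuous_const).measurable.subtype_mk
  have h1 : (fun v : ↥(adelicUnipotent F E c 2) => (borelHeight (W * ((v : (quasiSplit F E c 2).Adelic) * (T * x))) : ℝ) ^ σ) =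
      fun v : ↥(adelicUnipotent F E c 2) => Φ (⟨T⁻¹ * (v : (quasiSplit F E c 2).Adelic) * T, conj_mem_adelicUnipotent (t : borelAdelic F E c 2).2 v.2⟩ : ↥(adelicUnipotent F E c 2)) := by
    funext v
    simp only [hΦ]
    rw [show T * (T⁻¹ * (v : (quasiSplit F E c 2).Adelic) * T * x) = (v : (quasiSplit F E c 2).Adelic) * (T * x) by group]
  have h2 : ∀ u : ↥(adelicUnipotent F E c 2), Φ u = ((IdeleClassGroup.ideleNorm E (d 0) : ℝ) ^ σ)⁻¹ * (borelHeight (W * ((u : (quasiSplit F E c 2).Adelic) * x)) : ℝ) ^ σ := by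
    intro u
    simp only [hΦ]
    rw [borelHeight_weylLongU_mul_diag_mul hd, NNReal.coe_mul, NNReal.coe_inv,
      Real.mul_rpow (inv_nonneg.2 (NNReal.coe_nonneg _)) (NNReal.coe_nonneg _), Real.inv_rpow (NNReal.coe_nonneg _)]
  rw [h1, ← integral_map hκ.aemeasurable hΦm.aestronglyMeasurable, map_torusConj_eq_torusRootModulus_smul_two hc hc1 ν t hd, integral_smul_measure,
    ENNReal.coe_toReal]
  simp_rw [h2]
  rw [integral_const_mul, smul_eq_mul, mul_assoc]


/-! ## §3 `M(w₀) H^σ = c(σ)·H^{1−σ}`: the standard intertwining integral of `U(J₂)` evaluated at every `g` -/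

/-- **THE STANDARD INTERTWINING INTEGRAL OF `U(J₂)`**: `∫_{N(𝔸)} H(w₀ v g)^σ dν(v) = c(σ)·H(g)^{1−σ}` with `c(σ) := ∫_{N(𝔸)} H(w₀ v)^σ dν(v)`, for every `g` and every real `σ`
(Iwasawa `g = b k` ★ `hBK` and `H`, `H(w₀ v ·)` right-`K_U`-invariant ★; Levi `b = t n` ★ `torusPart`; §2 at `t`; `N(𝔸)` abelian ★; `δ_B(t) = ‖d₀‖`, `H(b) = ‖d₁‖⁻¹ = ‖d₀‖` ★ torus relations).
No convergence hypothesis: both sides carry the same Bochner junk. [cite: MoeglinWaldspurger1995, II.1.6] [cite: Garrett2018, §2.8] [cite: Rogawski1990, §2.2] -/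
theorem integral_borelHeight_weylLongU_mul_rpow_eq (hc : c * c = 1) (hc1 : c ≠ 1) (ν : Measure ↥(adelicUnipotent F E c 2)) [ν.IsHaarMeasure]
    (hBK : ∀ g : (quasiSplit F E c 2).Adelic, ∃ b ∈ borelAdelic F E c 2, ∃ k : (quasiSplit F E c 2).Adelic, adelicVal F E c 2 ((StdForm.antidiagonal 2).over E) k ∈ standardMaximalCompactGL 2 E ∧ g = b * k)
    (σ : ℝ) (g : (quasiSplit F E c 2).Adelic) :
    ∫ v : ↥(adelicUnipotent F E c 2), (borelHeight ((quasiSplit F E c 2).toAdelic (weylLongU (c : E →+* E) (rfl : (StdForm.antidiagonal 2).over E = (StdForm.antidiagonal 2).over E)) * ((v : (quasiSplit F E c 2).Adelic) * g)) : ℝ) ^ σ ∂ν =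
      (∫ v : ↥(adelicUnipotent F E c 2), (borelHeight ((quasiSplit F E c 2).toAdelic (weylLongU (c : E →+* E) (rfl : (StdForm.antidiagonal 2).over E = (StdForm.antidiagonal 2).over E)) * (v : (quasiSplit F E c 2).Adelic)) : ℝ) ^ σ ∂ν) * (borelHeight g : ℝ) ^ (1 - σ) := by
  haveI := locallyCompactSpace_adeleRing' E
  haveI := isMulRightInvariant_of_isMulLeftInvariant_two ν
  obtain ⟨b, hb, k, hk, rfl⟩ := hBK g
  have hkK : k ∈ ((standardMaximalCompactGL 2 E).comap (adelicVal F E c 2 ((StdForm.antidiagonal 2).over E)) : Subgroup (quasiSplit F E c 2).Adelic) := Subgroup.mem_comap.2 hk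
  -- strip `k`
  have e1 : ∀ v : ↥(adelicUnipotent F E c 2), borelHeight ((quasiSplit F E c 2).toAdelic (weylLongU (c : E →+* E) (rfl : (StdForm.antidiagonal 2).over E = (StdForm.antidiagonal 2).over E)) * ((v : (quasiSplit F E c 2).Adelic) * (b * k))) = borelHeight ((quasiSplit F E c 2).toAdelic (weylLongU (c : E →+* E) (rfl : (StdForm.antidiagonal 2).over E = (StdForm.antidiagonal 2).over E)) * ((v : (quasiSplit F E c 2).Adelic) * b)) := fun v => by
    rw [show (quasiSplit F E c 2).toAdelic (weylLongU (c : E →+* E) (rfl : (StdForm.antidiagonal 2).over E = (StdForm.antidiagonal 2).over E)) * ((v : (quasiSplit F E c 2).Adelic) * (b * k)) = (quasiSplit F E c 2).toAdelic (weylLongU (c : E →+* E) (rfl : (StdForm.antidiagonal 2).over E = (StdForm.antidiagonal 2).over E)) * ((v : (quasiSplit F E c 2).Adelic) * b) * k by group]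
    exact borelHeight_mul_of_mem_comap_standardMaximalCompactGL hkK _
  simp_rw [e1]
  rw [borelHeight_mul_of_mem_comap_standardMaximalCompactGL hkK b]
  -- Levi `b = t n`
  set tB : torusInBorel F E c 2 := ⟨torusPart ⟨b, hb⟩, (mem_torusInBorel_iff _).2 (torusPart_mem_torusAdelic _)⟩ with htB
  have hd : glDiagonal 2 (AdeleRing (𝓞 E) E) (diagUnit hb) = adelicVal F E c 2 _ ((tB : borelAdelic F E c 2) : (quasiSplit F E c 2).Adelic) := (adelicVal_torusPart ⟨b, hb⟩).symm
  have hn : (((tB : borelAdelic F E c 2) : (quasiSplit F E c 2).Adelic))⁻¹ * b ∈ adelicUnipotent F E c 2 := torusPart_inv_mul_mem_adelicUnipotent ⟨b, hb⟩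
  have key := integral_borelHeight_weylLongU_torus_mul_rpow hc hc1 ν tB hd σ ((((tB : borelAdelic F E c 2) : (quasiSplit F E c 2).Adelic))⁻¹ * b)
  rw [mul_inv_cancel_left] at key
  -- `N(𝔸)` unimodular: right-translate by `n`
  have e2 : ∫ v : ↥(adelicUnipotent F E c 2), (borelHeight ((quasiSplit F E c 2).toAdelic (weylLongU (c : E →+* E) (rfl : (StdForm.antidiagonal 2).over E = (StdForm.antidiagonal 2).over E)) * ((v : (quasiSplit F E c 2).Adelic) * ((((tB : borelAdelic F E c 2) : (quasiSplit F E c 2).Adelic))⁻¹ * b))) : ℝ) ^ σ ∂ν =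
      ∫ v : ↥(adelicUnipotent F E c 2), (borelHeight ((quasiSplit F E c 2).toAdelic (weylLongU (c : E →+* E) (rfl : (StdForm.antidiagonal 2).over E = (StdForm.antidiagonal 2).over E)) * (v : (quasiSplit F E c 2).Adelic)) : ℝ) ^ σ ∂ν := by
    have h := integral_mul_right_eq_self (μ := ν) (fun v : ↥(adelicUnipotent F E c 2) => (borelHeight ((quasiSplit F E c 2).toAdelic (weylLongU (c : E →+* E) (rfl : (StdForm.antidiagonal 2).over E = (StdForm.antidiagonal 2).over E)) * (v : (quasiSplit F E c 2).Adelic)) : ℝ) ^ σ) ⟨_, hn⟩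
    simpa only [Subgroup.coe_mul] using h
  rw [key, e2]
  -- torus relations: `δ_B(t) = ‖d₀‖`, `H(b) = H(t n) = ‖d₁‖⁻¹ = ‖d₀‖`
  have hδ : (torusRootModulus E 2 (diagUnit hb) : ℝ) = (IdeleClassGroup.ideleNorm E (diagUnit hb 0) : ℝ) := by
    rw [torusRootModulus_two_eq tB hd, AdeleRing.distribHaarChar_eq_ideleNorm]
  have hHb : (borelHeight b : ℝ) = (IdeleClassGroup.ideleNorm E (diagUnit hb 0) : ℝ) := by
    have h2 := distribHaarChar_torus_two tB hd
    rw [AdeleRing.distribHaarChar_eq_ideleNorm, AdeleRing.distribHaarChar_eq_ideleNorm] at h2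
    have hlast : lastEntryUnit (tB : borelAdelic F E c 2).2 = diagUnit hb 1 := Units.ext (coe_lastEntryUnit_of_glDiagonal_eq hd)
    conv_lhs => rw [← mul_inv_cancel_left (((tB : borelAdelic F E c 2) : (quasiSplit F E c 2).Adelic)) b, borelHeight_borel_mul (tB : borelAdelic F E c 2).2,
      show (((tB : borelAdelic F E c 2) : (quasiSplit F E c 2).Adelic))⁻¹ * b = ((((tB : borelAdelic F E c 2) : (quasiSplit F E c 2).Adelic))⁻¹ * b) * 1 from (mul_one _).symm,
      borelHeight_unipotent_mul hn, borelHeight_one, mul_one, hlast, h2, inv_inv]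
  have hpos : (0 : ℝ) < (IdeleClassGroup.ideleNorm E (diagUnit hb 0) : ℝ) := ideleNorm_real_pos _
  rw [hδ, hHb, Real.rpow_sub hpos, Real.rpow_one]
  field_simp


/-! ## §4 Finiteness `c(σ) < ∞` from Godement finiteness (★ R5a through ★ R3's left↔right dictionary) -/

/-- **`v ↦ H(w₀ v g)^{Re z} ∈ L¹(ν)`** from the Godement finiteness of the standard section `H^z` at `g` in ★ R3's spelling: ★ R3's dictionary `φ(y) := f(y⁻¹)` feeds ★ R5a
`integrable_intertwiningU_integrand_quasiSplit_two` at `g⁻¹`, and `v ↦ v⁻¹` preserves `ν`. [cite: MoeglinWaldspurger1995, II.1.6] [cite: Godement1964, §1.1] -/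
theorem integrable_borelHeight_weylLongU_mul_rpow (ν : Measure ↥(adelicUnipotent F E c 2)) [ν.IsHaarMeasure] [ν.IsInvInvariant]
    {𝓕 : Set ↥(adelicUnipotent F E c 2)} (h𝓕N : IsFundamentalDomain ↥(rationalUnipotent F E c 2) 𝓕 ν) (z : ℂ) (g : (quasiSplit F E c 2).Adelic)
    (hfin : ∫⁻ u in 𝓕, (∑' q : (quasiSplit F E c 2).quotientSubgroup ⧸ (borelAdelic F E c 2).subgroupOf (quasiSplit F E c 2).quotientSubgroup,
        ‖flatSectionU (fun _ : (quasiSplit F E c 2).Adelic => (1 : ℂ)) z ((((q.out : (quasiSplit F E c 2).quotientSubgroup) : (quasiSplit F E c 2).Adelic))⁻¹ * (u : (quasiSplit F E c 2).Adelic) * g)‖ₑ) ∂ν < ∞) :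
    Integrable (fun v : ↥(adelicUnipotent F E c 2) => (borelHeight ((quasiSplit F E c 2).toAdelic (weylLongU (c : E →+* E) (rfl : (StdForm.antidiagonal 2).over E = (StdForm.antidiagonal 2).over E)) * ((v : (quasiSplit F E c 2).Adelic) * g)) : ℝ) ^ z.re) ν := by
  set f : (quasiSplit F E c 2).Adelic → ℂ := flatSectionU (fun _ : (quasiSplit F E c 2).Adelic => (1 : ℂ)) z with hf
  have hfm : Measurable f := measurable_flatSectionU measurable_const z
  have hfN : ∀ (n : ↥(adelicUnipotent F E c 2)) (y : (quasiSplit F E c 2).Adelic), f ((n : (quasiSplit F E c 2).Adelic) * y) = f y := fun n y => by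
    simp only [hf, flatSectionU_apply, borelHeight_unipotent_mul n.2 y]
  have hfB : ∀ b ∈ borelU (c : E →+* E) ((StdForm.antidiagonal 2).over E), ∀ x : (quasiSplit F E c 2).Adelic, f ((quasiSplit F E c 2).toAdelic b * x) = f x :=
    forall_arithmeticBorel_iff.1 fun b hb x => by simp only [hf, flatSectionU_apply, K2E1TruncatedEisensteinExplicit.borelHeight_arithmeticBorel_mul hb]
  -- ★ R3's dictionary
  set φ : (quasiSplit F E c 2).Adelic → ℂ := fun y => f y⁻¹ with hφ
  have hφm : Measurable φ := hfm.comp measurable_inv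
  have hφN : ∀ (y : (quasiSplit F E c 2).Adelic) (n : ↥(adelicUnipotent F E c 2)), φ (y * n) = φ y := fun y n => by
    simp only [hφ, _root_.mul_inv_rev, ← Subgroup.coe_inv]; exact hfN n⁻¹ y⁻¹
  have hφB : ∀ (y : (quasiSplit F E c 2).Adelic) (b : (quasiSplit F E c 2).quotientSubgroup),
      b ∈ (borelAdelic F E c 2).subgroupOf (quasiSplit F E c 2).quotientSubgroup → φ (y * (b : (quasiSplit F E c 2).Adelic)) = φ y := fun y b hb => by
    simp only [hφ, _root_.mul_inv_rev]
    have key := apply_mul_of_mem_borelQuotient hfB (Subgroup.inv_mem _ hb) y⁻¹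
    rwa [Subgroup.coe_inv] at key
  have hfin' : ∫⁻ u in 𝓕, (∑' q : (quasiSplit F E c 2).quotientSubgroup ⧸ (borelAdelic F E c 2).subgroupOf (quasiSplit F E c 2).quotientSubgroup,
      ‖φ (g⁻¹ * (u : (quasiSplit F E c 2).Adelic)⁻¹ * ((q.out : (quasiSplit F E c 2).quotientSubgroup) : (quasiSplit F E c 2).Adelic))‖ₑ) ∂ν < ∞ := by
    simpa only [hφ, _root_.mul_inv_rev, inv_inv, mul_assoc] using hfin
  have hI := ((integrable_intertwiningU_integrand_quasiSplit_two ν hφm hφN hφB h𝓕N g⁻¹ hfin').comp_inv).norm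
  refine hI.congr (Eventually.of_forall fun v => ?_)
  have hpos : (0 : ℝ) < (borelHeight ((quasiSplit F E c 2).toAdelic (weylLongU (c : E →+* E) (rfl : (StdForm.antidiagonal 2).over E = (StdForm.antidiagonal 2).over E)) * ((v : (quasiSplit F E c 2).Adelic) * g)) : ℝ) := by exact_mod_cast borelHeight_pos _
  simp only [hφ, hf, _root_.mul_inv_rev, inv_inv, Subgroup.coe_inv, mul_assoc, flatSectionU_apply, one_mul, Complex.norm_cpow_eq_rpow_re_of_pos hpos]

/-! ## §5 The flat growth of `M(w₀) f_z` on `U(J₂)`: `hφ̃C` of ★ `…_two_int` discharged -/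

/-- **`‖(M(w₀) f_z)(g) · H(g)^{z−1}‖ ≤ C_φ · c(Re z)`** on `U(J₂)` for `f_z = φ·H^z` with `‖φ‖ ≤ C_φ`: `|f_z(w₀ v g)| ≤ C_φ H(w₀ v g)^{Re z}` (integrable, §4), §3, and `H^{1−Re z}·H^{Re z−1} = 1`
— the boundedness `hφ̃C` of the intertwined coefficient of ★ `maassSelberg_flatSectionU_two_int`, from `hfinz` and `hφC` alone. [cite: MoeglinWaldspurger1995, II.1.6] [cite: Garrett2018, §2.8] -/
theorem norm_intertwinedCoeff_le (hc : c * c = 1) (hc1 : c ≠ 1) (ν : Measure ↥(adelicUnipotent F E c 2)) [ν.IsHaarMeasure] [ν.IsInvInvariant]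
    (hBK : ∀ g : (quasiSplit F E c 2).Adelic, ∃ b ∈ borelAdelic F E c 2, ∃ k : (quasiSplit F E c 2).Adelic, adelicVal F E c 2 ((StdForm.antidiagonal 2).over E) k ∈ standardMaximalCompactGL 2 E ∧ g = b * k)
    {𝓕 : Set ↥(adelicUnipotent F E c 2)} (h𝓕N : IsFundamentalDomain ↥(rationalUnipotent F E c 2) 𝓕 ν)
    {φ : (quasiSplit F E c 2).Adelic → ℂ} {Cφ : ℝ} (hφC : ∀ x, ‖φ x‖ ≤ Cφ) (z : ℂ) (g : (quasiSplit F E c 2).Adelic)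
    (hfin : ∫⁻ u in 𝓕, (∑' q : (quasiSplit F E c 2).quotientSubgroup ⧸ (borelAdelic F E c 2).subgroupOf (quasiSplit F E c 2).quotientSubgroup,
        ‖flatSectionU (fun _ : (quasiSplit F E c 2).Adelic => (1 : ℂ)) z ((((q.out : (quasiSplit F E c 2).quotientSubgroup) : (quasiSplit F E c 2).Adelic))⁻¹ * (u : (quasiSplit F E c 2).Adelic) * g)‖ₑ) ∂ν < ∞) :
    ‖(fun g : (quasiSplit F E c 2).Adelic => (∫ v : ↥(adelicUnipotent F E c 2), flatSectionU φ z ((quasiSplit F E c 2).toAdelic (weylLongU (c : E →+* E) (rfl : (StdForm.antidiagonal 2).over E = (StdForm.antidiagonal 2).over E)) * ((v : (quasiSplit F E c 2).Adelic) * g)) ∂ν) * ((borelHeight g : ℝ) : ℂ) ^ (z - 1)) g‖ ≤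
      Cφ * ∫ v : ↥(adelicUnipotent F E c 2), (borelHeight ((quasiSplit F E c 2).toAdelic (weylLongU (c : E →+* E) (rfl : (StdForm.antidiagonal 2).over E = (StdForm.antidiagonal 2).over E)) * (v : (quasiSplit F E c 2).Adelic)) : ℝ) ^ z.re ∂ν := by
  have hpos : (0 : ℝ) < (borelHeight g : ℝ) := by exact_mod_cast borelHeight_pos g
  have hCφ : 0 ≤ Cφ := (norm_nonneg _).trans (hφC 1)
  have hI := integrable_borelHeight_weylLongU_mul_rpow ν h𝓕N z g hfin
  -- `|f_z(w₀ v g)| ≤ C_φ · H(w₀ v g)^{Re z}`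
  have hle : ∀ v : ↥(adelicUnipotent F E c 2), ‖flatSectionU φ z ((quasiSplit F E c 2).toAdelic (weylLongU (c : E →+* E) (rfl : (StdForm.antidiagonal 2).over E = (StdForm.antidiagonal 2).over E)) * ((v : (quasiSplit F E c 2).Adelic) * g))‖ ≤ Cφ * (borelHeight ((quasiSplit F E c 2).toAdelic (weylLongU (c : E →+* E) (rfl : (StdForm.antidiagonal 2).over E = (StdForm.antidiagonal 2).over E)) * ((v : (quasiSplit F E c 2).Adelic) * g)) : ℝ) ^ z.re := fun v => by
    have hp : (0 : ℝ) < (borelHeight ((quasiSplit F E c 2).toAdelic (weylLongU (c : E →+* E) (rfl : (StdForm.antidiagonal 2).over E = (StdForm.antidiagonal 2).over E)) * ((v : (quasiSplit F E c 2).Adelic) * g)) : ℝ) := by exact_mod_cast borelHeight_pos _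
    rw [flatSectionU_apply, norm_mul, Complex.norm_cpow_eq_rpow_re_of_pos hp]
    exact mul_le_mul_of_nonneg_right (hφC _) (Real.rpow_nonneg hp.le _)
  have hM : ‖∫ v : ↥(adelicUnipotent F E c 2), flatSectionU φ z ((quasiSplit F E c 2).toAdelic (weylLongU (c : E →+* E) (rfl : (StdForm.antidiagonal 2).over E = (StdForm.antidiagonal 2).over E)) * ((v : (quasiSplit F E c 2).Adelic) * g)) ∂ν‖ ≤ Cφ * ((∫ v : ↥(adelicUnipotent F E c 2), (borelHeight ((quasiSplit F E c 2).toAdelic (weylLongU (c : E →+* E) (rfl : (StdForm.antidiagonal 2).over E = (StdForm.antidiagonal 2).over E)) * (v : (quasiSplit F E c 2).Adelic)) : ℝ) ^ z.re ∂ν) * (borelHeight g : ℝ) ^ (1 - z.re)) := by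
    rw [← integral_borelHeight_weylLongU_mul_rpow_eq hc hc1 ν hBK z.re g, ← integral_const_mul]
    exact norm_integral_le_of_norm_le (hI.const_mul Cφ) (Eventually.of_forall hle)
  have hc0 : 0 ≤ ∫ v : ↥(adelicUnipotent F E c 2), (borelHeight ((quasiSplit F E c 2).toAdelic (weylLongU (c : E →+* E) (rfl : (StdForm.antidiagonal 2).over E = (StdForm.antidiagonal 2).over E)) * (v : (quasiSplit F E c 2).Adelic)) : ℝ) ^ z.re ∂ν := integral_nonneg fun v => Real.rpow_nonneg (NNReal.coe_nonneg _) _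
  dsimp only
  rw [norm_mul, Complex.norm_cpow_eq_rpow_re_of_pos hpos, Complex.sub_re, Complex.one_re]
  calc ‖∫ v : ↥(adelicUnipotent F E c 2), flatSectionU φ z ((quasiSplit F E c 2).toAdelic (weylLongU (c : E →+* E) (rfl : (StdForm.antidiagonal 2).over E = (StdForm.antidiagonal 2).over E)) * ((v : (quasiSplit F E c 2).Adelic) * g)) ∂ν‖ * (borelHeight g : ℝ) ^ (z.re - 1)
      ≤ Cφ * ((∫ v : ↥(adelicUnipotent F E c 2), (borelHeight ((quasiSplit F E c 2).toAdelic (weylLongU (c : E →+* E) (rfl : (StdForm.antidiagonal 2).over E = (StdForm.antidiagonal 2).over E)) * (v : (quasiSplit F E c 2).Adelic)) : ℝ) ^ z.re ∂ν) * (borelHeight g : ℝ) ^ (1 - z.re)) * (borelHeight g : ℝ) ^ (z.re - 1) :=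
        mul_le_mul_of_nonneg_right hM (Real.rpow_nonneg hpos.le _)
    _ = Cφ * ∫ v : ↥(adelicUnipotent F E c 2), (borelHeight ((quasiSplit F E c 2).toAdelic (weylLongU (c : E →+* E) (rfl : (StdForm.antidiagonal 2).over E = (StdForm.antidiagonal 2).over E)) * (v : (quasiSplit F E c 2).Adelic)) : ℝ) ^ z.re ∂ν := by
        rw [mul_assoc, mul_assoc, ← Real.rpow_add hpos, show (1 - z.re) + (z.re - 1) = 0 by ring, Real.rpow_zero, mul_one]

end Scaling

/-! ## §6 The Maass–Selberg relation for flat sections of `U(J₂)` with NO coefficient-growth input left -/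

section Fin

variable [MeasurableSpace (quasiSplit F E c 2).Adelic] [BorelSpace (quasiSplit F E c 2).Adelic]
variable [MeasurableSpace (AdeleRing (𝓞 E) E)ˣ] [BorelSpace (AdeleRing (𝓞 E) E)ˣ]

/-- **THE MAASS–SELBERG RELATION FOR FLAT SECTIONS OF `U(J₂)`, coefficient growth discharged** = ★ `maassSelberg_flatSectionU_two_int` (p857847) with `hφ̃C`, `hφ̃′C` PROVED by §5 from
`hfinz`, `hfinz′` and `‖φ‖ ≤ C_φ`, `‖φ′‖ ≤ C_φ′` (twin of ★ `maassSelberg_flatSectionU_three_fin`). [cite: MoeglinWaldspurger1995, II.1.6–II.1.7 and IV.2.1–IV.2.3] [cite: Garrett2018, §2.8 and §11.3] -/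
theorem maassSelberg_flatSectionU_two_fin (hc : c * c = 1) (hc1 : c ≠ 1)
    (μ : Measure (quasiSplit F E c 2).automorphicQuotient) [(quasiSplit F E c 2).IsAutomorphicMeasure μ]
    (νG : Measure (quasiSplit F E c 2).Adelic) [νG.IsHaarMeasure] [νG.IsInvInvariant]
    (μK : Measure ((standardMaximalCompactGL 2 E).comap (adelicVal F E c 2 ((StdForm.antidiagonal 2).over E)) : Subgroup (quasiSplit F E c 2).Adelic))
    [μK.IsHaarMeasure]
    (νI : Measure (AdeleRing (𝓞 E) E)ˣ) [νI.IsHaarMeasure]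
    (hBK : ∀ g : (quasiSplit F E c 2).Adelic, ∃ b ∈ borelAdelic F E c 2, ∃ k : (quasiSplit F E c 2).Adelic,
      adelicVal F E c 2 ((StdForm.antidiagonal 2).over E) k ∈ standardMaximalCompactGL 2 E ∧ g = b * k)
    {𝓕I : Set (AdeleRing (𝓞 E) E)ˣ} (h𝓕I : IsIdeleClassDomain E 𝓕I)
    (ν : Measure ↥(adelicUnipotent F E c 2)) [ν.IsHaarMeasure] [ν.IsInvInvariant]
    {𝓕 : Set ↥(adelicUnipotent F E c 2)} (h𝓕N : IsFundamentalDomain ↥(rationalUnipotent F E c 2) 𝓕 ν) (h𝓕1 : ν 𝓕 = 1) :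
    ∃ cμ K : ℝ, 0 < cμ ∧ 0 < K ∧
      ∀ {β : (quasiSplit F E c 2).Adelic → ℝ≥0∞}, IsCoveringWeight ((arithmeticBorel F E c 2).map (quasiSplit F E c 2).arithmeticSubgroup.subtype) β →
      ∀ {T : ℝ≥0}, 1 ≤ T →
      ∀ {φ φ' : (quasiSplit F E c 2).Adelic → ℂ},
      Measurable φ →
        (∀ (n : unipotentInBorel F E c 2) (y : (quasiSplit F E c 2).Adelic), φ (((n : borelAdelic F E c 2) : (quasiSplit F E c 2).Adelic) * y) = φ y) →
        (∀ b ∈ arithmeticBorel F E c 2, ∀ y : (quasiSplit F E c 2).Adelic, φ ((b : (quasiSplit F E c 2).Adelic) * y) = φ y) →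
      ∀ {Cφ : ℝ}, (∀ x, ‖φ x‖ ≤ Cφ) →
      Measurable φ' →
        (∀ (n : unipotentInBorel F E c 2) (y : (quasiSplit F E c 2).Adelic), φ' (((n : borelAdelic F E c 2) : (quasiSplit F E c 2).Adelic) * y) = φ' y) →
        (∀ b ∈ arithmeticBorel F E c 2, ∀ y : (quasiSplit F E c 2).Adelic, φ' ((b : (quasiSplit F E c 2).Adelic) * y) = φ' y) →
      ∀ {Cφ' : ℝ}, (∀ x, ‖φ' x‖ ≤ Cφ') →
      ∀ {z z' : ℂ}, 1 < z'.re → z'.re < z.re →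
      -- NAMED: the Godement finiteness of the standard sections `H^z`, `H^{z′}` in ★ R3's spelling — it now ALSO bounds `φ̃`, `φ̃′` (§5)
        (∀ g : (quasiSplit F E c 2).Adelic, ∫⁻ u in 𝓕, (∑' q : (quasiSplit F E c 2).quotientSubgroup ⧸ (borelAdelic F E c 2).subgroupOf (quasiSplit F E c 2).quotientSubgroup,
            ‖flatSectionU (fun _ : (quasiSplit F E c 2).Adelic => (1 : ℂ)) z ((((q.out : (quasiSplit F E c 2).quotientSubgroup) : (quasiSplit F E c 2).Adelic))⁻¹ * (u : (quasiSplit F E c 2).Adelic) * g)‖ₑ) ∂ν < ∞) →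
        (∀ g : (quasiSplit F E c 2).Adelic, ∫⁻ u in 𝓕, (∑' q : (quasiSplit F E c 2).quotientSubgroup ⧸ (borelAdelic F E c 2).subgroupOf (quasiSplit F E c 2).quotientSubgroup,
            ‖flatSectionU (fun _ : (quasiSplit F E c 2).Adelic => (1 : ℂ)) z' ((((q.out : (quasiSplit F E c 2).quotientSubgroup) : (quasiSplit F E c 2).Adelic))⁻¹ * (u : (quasiSplit F E c 2).Adelic) * g)‖ₑ) ∂ν < ∞) →
        (∀ g : (quasiSplit F E c 2).Adelic,
          Summable fun q : Quotient (orbitRel ↥(borelU (c : E →+* E) ((StdForm.antidiagonal 2).over E)) ↥(unitaryGroupOfForm (c : E →+* E) ((StdForm.antidiagonal 2).over E))) =>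
            flatSectionU φ z ((quasiSplit F E c 2).toAdelic (q.out : ↥(unitaryGroupOfForm (c : E →+* E) ((StdForm.antidiagonal 2).over E))) * g)) →
      -- the truncated second series `Λ′ := Λ^T E(f′_{z′})`: Borel, `G(F)`-invariant, bounded (★ R6e ∕ p857707 at CM), and its Eisenstein series integrable along `N(F)∖N(𝔸)·g` (R4a)
        Measurable (truncation ν 𝓕 T (eisensteinSeriesU (flatSectionU φ' z'))) →
        (∀ (γ : (quasiSplit F E c 2).arithmeticSubgroup) (x : (quasiSplit F E c 2).Adelic), truncation ν 𝓕 T (eisensteinSeriesU (flatSectionU φ' z')) ((γ : (quasiSplit F E c 2).Adelic) * x) = truncation ν 𝓕 T (eisensteinSeriesU (flatSectionU φ' z')) x) →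
        ∀ {M₁ : ℝ}, (∀ g, ‖truncation ν 𝓕 T (eisensteinSeriesU (flatSectionU φ' z')) g‖ ≤ M₁) →
        (∀ g : (quasiSplit F E c 2).Adelic, IntegrableOn (fun u : ↥(adelicUnipotent F E c 2) => eisensteinSeriesU (flatSectionU φ' z') ((u : (quasiSplit F E c 2).Adelic) * g)) 𝓕 ν) →
        ∫⁻ g, β g * ‖({y : (quasiSplit F E c 2).Adelic | borelHeight y ≤ T}.indicator (flatSectionU φ z) g - {y : (quasiSplit F E c 2).Adelic | T < borelHeight y}.indicator (flatSectionU (fun g : (quasiSplit F E c 2).Adelic => (∫ v : ↥(adelicUnipotent F E c 2), flatSectionU φ z ((quasiSplit F E c 2).toAdelic (weylLongU (c : E →+* E) (rfl : (StdForm.antidiagonal 2).over E = (StdForm.antidiagonal 2).over E)) * ((v : (quasiSplit F E c 2).Adelic) * g)) ∂ν) * ((borelHeight g : ℝ) : ℂ) ^ (z - 1)) (1 - z)) g)‖ₑ ∂νG < ∞ →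
        Integrable (fun g => (β g).toReal • (({y : (quasiSplit F E c 2).Adelic | borelHeight y ≤ T}.indicator (flatSectionU φ z) g - {y : (quasiSplit F E c 2).Adelic | T < borelHeight y}.indicator (flatSectionU (fun g : (quasiSplit F E c 2).Adelic => (∫ v : ↥(adelicUnipotent F E c 2), flatSectionU φ z ((quasiSplit F E c 2).toAdelic (weylLongU (c : E →+* E) (rfl : (StdForm.antidiagonal 2).over E = (StdForm.antidiagonal 2).over E)) * ((v : (quasiSplit F E c 2).Adelic) * g)) ∂ν) * ((borelHeight g : ℝ) : ℂ) ^ (z - 1)) (1 - z)) g) * conj (∫ u : ↥(adelicUnipotent F E c 2), {y : (quasiSplit F E c 2).Adelic | T < borelHeight y}.indicator (flatSectionU φ' z' + flatSectionU (fun g : (quasiSplit F E c 2).Adelic => (∫ v : ↥(adelicUnipotent F E c 2), flatSectionU φ' z' ((quasiSplit F E c 2).toAdelic (weylLongU (c : E →+* E) (rfl : (StdForm.antidiagonal 2).over E = (StdForm.antidiagonal 2).over E)) * ((v : (quasiSplit F E c 2).Adelic) * g)) ∂ν) * ((borelHeight g : ℝ) : ℂ) ^ (z' - 1)) (1 - z'))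 ((quasiSplit F E c 2).toAdelic (weylLongU (c : E →+* E) (rfl : (StdForm.antidiagonal 2).over E = (StdForm.antidiagonal 2).over E)) * ((u : (quasiSplit F E c 2).Adelic) * g)) ∂ν))) νG →
      -- ★ p857605's absolute convergence (`h := χ`, `F := ψ`)
        ∫⁻ g, β g * ∫⁻ u : ↥(adelicUnipotent F E c 2), ‖{y : (quasiSplit F E c 2).Adelic | T < borelHeight y}.indicator (flatSectionU φ' z' + flatSectionU (fun g : (quasiSplit F E c 2).Adelic => (∫ v : ↥(adelicUnipotent F E c 2), flatSectionU φ' z' ((quasiSplit F E c 2).toAdelic (weylLongU (c : E →+* E) (rfl : (StdForm.antidiagonal 2).over E = (StdForm.antidiagonal 2).over E)) * ((v : (quasiSplit F E c 2).Adelic) * g)) ∂ν) * ((borelHeight g : ℝ) : ℂ) ^ (z' - 1)) (1 - z')) ((quasiSplit F E c 2).toAdelic (weylLongU (c : E →+* E) (rfl : (StdForm.antidiagonal 2).over E = (StdForm.antidiagonal 2).over E)) * ((u : (quasiSplit F E c 2).Adelic) * g)) * conj ({y : (quasiSplit F E c 2).Adelic | borelHeight y ≤ T}.indicator (flatSectionU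 φ z) g - {y : (quasiSplit F E c 2).Adelic | T < borelHeight y}.indicator (flatSectionU (fun g : (quasiSplit F E c 2).Adelic => (∫ v : ↥(adelicUnipotent F E c 2), flatSectionU φ z ((quasiSplit F E c 2).toAdelic (weylLongU (c : E →+* E) (rfl : (StdForm.antidiagonal 2).over E = (StdForm.antidiagonal 2).over E)) * ((v : (quasiSplit F E c 2).Adelic) * g)) ∂ν) * ((borelHeight g : ℝ) : ℂ) ^ (z - 1)) (1 - z)) g)‖ₑ ∂ν ∂νG < ∞ →
        ∫⁻ g, β g * ∫⁻ u : ↥(adelicUnipotent F E c 2), ‖{y : (quasiSplit F E c 2).Adelic | T < borelHeight y}.indicator (flatSectionU φ' z' + flatSectionU (fun g : (quasiSplit F E c 2).Adelic => (∫ v : ↥(adelicUnipotent F E c 2), flatSectionU φ' z' ((quasiSplit F E c 2).toAdelic (weylLongU (c : E →+* E) (rfl : (StdForm.antidiagonal 2).over E = (StdForm.antidiagonal 2).over E)) * ((v : (quasiSplit F E c 2).Adelic) * g)) ∂ν) * ((borelHeight g : ℝ) : ℂ) ^ (z' - 1)) (1 - z')) g * conj ({y : (quasiSplit F E c 2).Adelic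 | borelHeight y ≤ T}.indicator (flatSectionU φ z) (((quasiSplit F E c 2).toAdelic (weylLongU (c : E →+* E) (rfl : (StdForm.antidiagonal 2).over E = (StdForm.antidiagonal 2).over E)))⁻¹ * ((u : (quasiSplit F E c 2).Adelic) * g)) - {y : (quasiSplit F E c 2).Adelic | T < borelHeight y}.indicator (flatSectionU (fun g : (quasiSplit F E c 2).Adelic => (∫ v : ↥(adelicUnipotent F E c 2), flatSectionU φ z ((quasiSplit F E c 2).toAdelic (weylLongU (c : E →+* E) (rfl : (StdForm.antidiagonal 2).over E = (StdForm.antidiagonal 2).over E)) * ((v : (quasiSplit F E c 2).Adelic) * g)) ∂ν) * ((borelHeight g : ℝ) : ℂ) ^ (z - 1)) (1 - z)) (((quasiSplit F E c 2).toAdelic (weylLongU (c : E →+* E) (rfl : (StdForm.antidiagonal 2).over E = (StdForm.antidiagonal 2).over E)))⁻¹ * ((u : (quasiSplit F E c 2).Adelic) * g)))‖ₑ ∂ν ∂νG < ∞ →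
      ∀ {Ξ₁ Ξ₂ Ξ₃ Ξ₄ : (AdeleRing (𝓞 E) E)ˣ → ℂ},
      Measurable Ξ₁ → ∀ {CΞ₁ : ℝ}, (∀ x, ‖Ξ₁ x‖ ≤ CΞ₁) → (∀ k ∈ GaloisRepresentations.principalIdeles E, ∀ x, Ξ₁ (k * x) = Ξ₁ x) →
        (∀ (r : ℝ≥0ˣ) (x : (AdeleRing (𝓞 E) E)ˣ), Ξ₁ (posRealIdele E r * x) = Ξ₁ x) →
        (∀ t : torusInBorel F E c 2,
          ∫ k, φ (((t : borelAdelic F E c 2) : (quasiSplit F E c 2).Adelic) * (k : (quasiSplit F E c 2).Adelic)) *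
              conj (φ' (((t : borelAdelic F E c 2) : (quasiSplit F E c 2).Adelic) * (k : (quasiSplit F E c 2).Adelic))) ∂μK = Ξ₁ (diagUnit (t : borelAdelic F E c 2).2 0)) →
      Measurable Ξ₂ → ∀ {CΞ₂ : ℝ}, (∀ x, ‖Ξ₂ x‖ ≤ CΞ₂) → (∀ k ∈ GaloisRepresentations.principalIdeles E, ∀ x, Ξ₂ (k * x) = Ξ₂ x) →
        (∀ (r : ℝ≥0ˣ) (x : (AdeleRing (𝓞 E) E)ˣ), Ξ₂ (posRealIdele E r * x) = Ξ₂ x) →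
        (∀ t : torusInBorel F E c 2,
          ∫ k, φ (((t : borelAdelic F E c 2) : (quasiSplit F E c 2).Adelic) * (k : (quasiSplit F E c 2).Adelic)) *
              conj ((fun g : (quasiSplit F E c 2).Adelic => (∫ v : ↥(adelicUnipotent F E c 2), flatSectionU φ' z' ((quasiSplit F E c 2).toAdelic (weylLongU (c : E →+* E) (rfl : (StdForm.antidiagonal 2).over E = (StdForm.antidiagonal 2).over E)) * ((v : (quasiSplit F E c 2).Adelic) * g)) ∂ν) * ((borelHeight g : ℝ) : ℂ) ^ (z' - 1)) (((t : borelAdelic F E c 2) : (quasiSplit F E c 2).Adelic) * (k : (quasiSplit F E c 2).Adelic))) ∂μK = Ξ₂ (diagUnit (t : borelAdelic F E c 2).2 0)) →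
      Measurable Ξ₃ → ∀ {CΞ₃ : ℝ}, (∀ x, ‖Ξ₃ x‖ ≤ CΞ₃) → (∀ k ∈ GaloisRepresentations.principalIdeles E, ∀ x, Ξ₃ (k * x) = Ξ₃ x) →
        (∀ (r : ℝ≥0ˣ) (x : (AdeleRing (𝓞 E) E)ˣ), Ξ₃ (posRealIdele E r * x) = Ξ₃ x) →
        (∀ t : torusInBorel F E c 2,
          ∫ k, (fun g : (quasiSplit F E c 2).Adelic => (∫ v : ↥(adelicUnipotent F E c 2), flatSectionU φ z ((quasiSplit F E c 2).toAdelic (weylLongU (c : E →+* E) (rfl : (StdForm.antidiagonal 2).over E = (StdForm.antidiagonal 2).over E)) * ((v : (quasiSplit F E c 2).Adelic) * g)) ∂ν) * ((borelHeight g : ℝ) : ℂ) ^ (z - 1)) (((t : borelAdelic F E c 2) : (quasiSplit F E c 2).Adelic) * (k : (quasiSplit F E c 2).Adelic)) *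
              conj (φ' (((t : borelAdelic F E c 2) : (quasiSplit F E c 2).Adelic) * (k : (quasiSplit F E c 2).Adelic))) ∂μK = Ξ₃ (diagUnit (t : borelAdelic F E c 2).2 0)) →
      Measurable Ξ₄ → ∀ {CΞ₄ : ℝ}, (∀ x, ‖Ξ₄ x‖ ≤ CΞ₄) → (∀ k ∈ GaloisRepresentations.principalIdeles E, ∀ x, Ξ₄ (k * x) = Ξ₄ x) →
        (∀ (r : ℝ≥0ˣ) (x : (AdeleRing (𝓞 E) E)ˣ), Ξ₄ (posRealIdele E r * x) = Ξ₄ x) →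
        (∀ t : torusInBorel F E c 2,
          ∫ k, (fun g : (quasiSplit F E c 2).Adelic => (∫ v : ↥(adelicUnipotent F E c 2), flatSectionU φ z ((quasiSplit F E c 2).toAdelic (weylLongU (c : E →+* E) (rfl : (StdForm.antidiagonal 2).over E = (StdForm.antidiagonal 2).over E)) * ((v : (quasiSplit F E c 2).Adelic) * g)) ∂ν) * ((borelHeight g : ℝ) : ℂ) ^ (z - 1)) (((t : borelAdelic F E c 2) : (quasiSplit F E c 2).Adelic) * (k : (quasiSplit F E c 2).Adelic)) *
              conj ((fun g : (quasiSplit F E c 2).Adelic => (∫ v : ↥(adelicUnipotent F E c 2), flatSectionU φ' z' ((quasiSplit F E c 2).toAdelic (weylLongU (c : E →+* E) (rfl : (StdForm.antidiagonal 2).over E = (StdForm.antidiagonal 2).over E)) * ((v : (quasiSplit F E c 2).Adelic) * g)) ∂ν) * ((borelHeight g : ℝ) : ℂ) ^ (z' - 1)) (((t : borelAdelic F E c 2) : (quasiSplit F E c 2).Adelic) * (k : (quasiSplit F E c 2).Adelic))) ∂μK = Ξ₄ (diagUnit (t : borelAdelic F E c 2).2 0)) →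
        ∫ x, (quasiSplit F E c 2).quotFun (truncation ν 𝓕 T (eisensteinSeriesU (flatSectionU φ z))) x * conj ((quasiSplit F E c 2).quotFun (truncation ν 𝓕 T (eisensteinSeriesU (flatSectionU φ' z'))) x) ∂μ =
          (cμ : ℂ) * ((K : ℂ) *
            ((((T : ℝ) : ℂ) ^ (z + conj z' - 1) / (z + conj z' - 1)) * (∫ x in {x : (AdeleRing (𝓞 E) E)ˣ | (IdeleClassGroup.ideleNorm E x : ℝ) ≤ 1} ∩ 𝓕I, ((IdeleClassGroup.ideleNorm E x : ℝ) : ℂ) * Ξ₁ x ∂νI)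
              + (((T : ℝ) : ℂ) ^ (z - conj z') / (z - conj z')) * (∫ x in {x : (AdeleRing (𝓞 E) E)ˣ | (IdeleClassGroup.ideleNorm E x : ℝ) ≤ 1} ∩ 𝓕I, ((IdeleClassGroup.ideleNorm E x : ℝ) : ℂ) * Ξ₂ x ∂νI)
              - (((T : ℝ) : ℂ) ^ (-(z - conj z')) / (z - conj z')) * (∫ x in {x : (AdeleRing (𝓞 E) E)ˣ | (IdeleClassGroup.ideleNorm E x : ℝ) ≤ 1} ∩ 𝓕I, ((IdeleClassGroup.ideleNorm E x : ℝ) : ℂ) * Ξ₃ x ∂νI)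
              - (((T : ℝ) : ℂ) ^ (-(z + conj z' - 1)) / (z + conj z' - 1)) * (∫ x in {x : (AdeleRing (𝓞 E) E)ˣ | (IdeleClassGroup.ideleNorm E x : ℝ) ≤ 1} ∩ 𝓕I, ((IdeleClassGroup.ideleNorm E x : ℝ) : ℂ) * Ξ₄ x ∂νI))) := by
  obtain ⟨cμ, K, hcμ, hK, h5⟩ := maassSelberg_flatSectionU_two_int hc hc1 μ νG μK νI hBK h𝓕I ν h𝓕N h𝓕1
  refine ⟨cμ, K, hcμ, hK, ?_⟩
  intro β hβ T hT φ φ' hφm hφN hφB Cφ hφC hφ'm hφ'N hφ'B Cφ' hφ'C z z' hz' hzz' hfinz hfinz' hsum hΛm hΛG M₁ hΛbdd hint' hψL1 hi₅ habs habs'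
    Ξ₁ Ξ₂ Ξ₃ Ξ₄ hΞ₁m CΞ₁ hΞ₁C hΞ₁K hΞ₁M hΞ₁ hΞ₂m CΞ₂ hΞ₂C hΞ₂K hΞ₂M hΞ₂ hΞ₃m CΞ₃ hΞ₃C hΞ₃K hΞ₃M hΞ₃ hΞ₄m CΞ₄ hΞ₄C hΞ₄K hΞ₄M hΞ₄
  exact h5 hβ hT hφm hφN hφB hφC hφ'm hφ'N hφ'B hφ'C hz' hzz'
    (fun x => norm_intertwinedCoeff_le hc hc1 ν hBK h𝓕N hφC z x (hfinz x)) (fun x => norm_intertwinedCoeff_le hc hc1 ν hBK h𝓕N hφ'C z' x (hfinz' x))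
    hfinz hfinz' hsum hΛm hΛG hΛbdd hint' hψL1 hi₅ habs habs'
    hΞ₁m hΞ₁C hΞ₁K hΞ₁M hΞ₁ hΞ₂m hΞ₂C hΞ₂K hΞ₂M hΞ₂ hΞ₃m hΞ₃C hΞ₃K hΞ₃M hΞ₃ hΞ₄m hΞ₄C hΞ₄K hΞ₄M hΞ₄

end Fin

end Summit.HodgeConjecture.HodgeConjecture.Cruxes.H413.K2E1IntertwiningGrowthU2

end
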